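import Literature.Analysis.FluidPDE.OseenMildWindowRepresentative
import Literature.Analysis.FluidPDE.NSBoundedMildOseenClassical
import Literature.Analysis.FluidPDE.KNSSSmoothingHolds
import Literature.Analysis.FluidPDE.ClassicalSolutionGlue
import HarnessLib

/-!
# Route HardyPointSink — `HardyAncientLimit`, step 6: an Oseen-mild bounded ancient field is a
# classical solution on `ℝ³ × ]-∞, 0[`

Support file for item stmt-NavierStokesRegularity-9138 (`HardyAncientLimit`) of route
`HardyPointSink` (problem `NavierStokesRegularity`).

For a field `w` continuous on the open half-space `{t < 0} × ℝ³`, bounded by `M`, with weakly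
divergence-free slices and solving the Oseen integral equation
`w(t) = e^{(t−s)Δ}w(s) − B¹ₛ(w, w)(t)` between all `s < t < 0` (the mild bounded ancient solution
produced by the blow-up, `HardyAncientLimit.oseenMild_of_boundedWeak_ancient`):

* `HardyAncientLimit.isSmoothSpaceTimeOn_of_oseen` — `w` is jointly `C^∞` on `{t < 0} × ℝ³`
  (KNSS 2009, Prop. 4.1, the tree's `knss2009_smoothing_holds`, window by window);
* `HardyAncientLimit.exists_isClassicalNSSolutionOn_window_of_oseen` — on every window `]t₀, 0[`
  there is a smooth pressure making `(w, q)` a classical solution (Fabes–Jones–Rivière 1972,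
  Thm. 2.1, the tree's `classical_of_smooth_isMildNSSolutionOn_holds`, applied to the translate
  `w(· + t₀)` and translated back — the proof of
  `IsTypeIAncientMild.exists_isClassicalNSSolutionOn_Ioo`);
* `HardyAncientLimit.exists_isClassicalNSSolutionOn_Iio_of_oseen` — the window pressures,
  normalised by `q(t, 0) = 0`, agree on overlaps (two pressures of the same velocity have the same
  gradient, hence differ by a function of time), and glue to ONE smooth pressure `P` with
  `(w, P)` a classical solution of the unforced Navier–Stokes system (`ν = 1`) on `]-∞, 0[`.

## References

* G. Koch, N. Nadirashvili, G. Seregin, V. Šverák, Acta Math. 203 (2009), Prop. 4.1, Rem. 4.1.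
* E. Fabes, B. Jones, N. Rivière, Arch. Ration. Mech. Anal. 45 (1972), Thm. 2.1.
* G. Seregin, V. Šverák, Comm. PDE 34 (2009), Thm. 2.4 (mild bounded ancient solutions are smooth).
-/

noncomputable section

open Literature.Analysis.FluidPDE Literature.Analysis
open MeasureTheory Set Function Filter Topology Metric TopologicalSpace
open scoped ENNReal NNReal InnerProductSpace RealInnerProductSpace ContDiff Laplacian

namespace Summit.NavierStokesRegularity.NavierStokesRegularity.Theorems

namespace HardyAncientLimit

variable {w : ℝ → EuclideanSpace ℝ (Fin 3) → EuclideanSpace ℝ (Fin 3)} {M : ℝ}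

/-! ### Smoothness (KNSS 2009, Prop. 4.1) -/

/-- **An Oseen-mild continuous bounded ancient field is jointly smooth** on `{t < 0} × ℝ³`: on each
window `]s, 0[` it IS the smooth function `e^{(t−s)Δ}w(s) − B¹ₛ(w, w)(t)` of KNSS 2009, Prop. 4.1
(`knss2009_smoothing_holds`). -/
theorem isSmoothSpaceTimeOn_of_oseen (hcont : ContinuousOn (uncurry w) (Iio 0 ×ˢ univ))
    (hM0 : 0 ≤ M) (hM : ∀ t < 0, ∀ x, ‖w t x‖ ≤ M)
    (hmild : ∀ s t : ℝ, s < t → t < 0 → ∀ x,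
      w t x = UnboundedOperators.heatExtension (w s) (t - s) x - oseenDuhamel 1 s w w t x) :
    IsSmoothSpaceTimeOn (Iio 0) w := by
  have hslice : ∀ {τ : ℝ}, τ < 0 → Continuous (w τ) := fun {τ} hτ =>
    hcont.comp_continuous (continuous_const.prodMk continuous_id) fun x => ⟨hτ, mem_univ _⟩
  have hbd : ∀ {τ : ℝ}, τ < 0 → eLpNorm (w τ) ∞ volume ≤ ENNReal.ofReal M := fun {τ} hτ => by
    rw [eLpNorm_exponent_top]
    exact eLpNormEssSup_le_of_ae_bound (Eventually.of_forall fun x => hM τ hτ x)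
  -- smoothness on each window `]s, 0[`
  have hwin : ∀ s < 0, IsSmoothSpaceTimeOn (Ioo s 0) w := by
    intro s hs
    have hmeas : AEStronglyMeasurable (uncurry w)
        ((volume : Measure (ℝ × EuclideanSpace ℝ (Fin 3))).restrict (Ioo s 0 ×ˢ univ)) :=
      (hcont.mono (prod_mono (fun _ hτ => hτ.2) subset_rfl)).aestronglyMeasurable
        (measurableSet_Ioo.prod MeasurableSet.univ)
    have key := knss2009_smoothing_holds (EuclideanSpace ℝ (Fin 3)) one_pos hs hM0
      (hslice hs).aestronglyMeasurable (hbd hs) hmeas (fun t ht => hbd ht.2)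
      (fun t ht => Eventually.of_forall fun x => by rw [one_mul]; exact hmild s t ht.1 ht.2 x)
    refine key.1.congr fun z hz => ?_
    show uncurry w z = UnboundedOperators.heatExtension (w s) (1 * (z.1 - s)) z.2 -
      oseenDuhamel 1 s w w z.1 z.2
    rw [one_mul]
    exact hmild s z.1 hz.1.1 hz.1.2 z.2
  intro z hz
  have hz1 : z.1 < 0 := hz.1
  have hopen : IsOpen (Ioo (z.1 - 1) 0 ×ˢ (univ : Set (EuclideanSpace ℝ (Fin 3)))) :=
    isOpen_Ioo.prod isOpen_univ
  have hmem : z ∈ Ioo (z.1 - 1) 0 ×ˢ (univ : Set (EuclideanSpace ℝ (Fin 3))) :=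
    ⟨⟨by linarith, hz1⟩, mem_univ _⟩
  exact (ContDiffOn.contDiffAt (hwin (z.1 - 1) (by linarith)) (hopen.mem_nhds hmem)).contDiffWithinAt

/-! ### Classical on windows (Fabes–Jones–Rivière) -/

/-- **On every window `]t₀, 0[` an Oseen-mild continuous bounded ancient field with weakly
divergence-free slices is a classical Navier–Stokes solution** (`ν = 1`, no force) for some smooth
pressure: mild in the duality form (`isBoundedAncientMildSolution_of_oseen` of the companion file,
restated inline) + smooth + bounded ⇒ classical (Fabes–Jones–Rivière 1972, Thm. 2.1, the tree's
`classical_of_smooth_isMildNSSolutionOn_holds`). The proof of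
`IsTypeIAncientMild.exists_isClassicalNSSolutionOn_Ioo`. -/
theorem exists_isClassicalNSSolutionOn_window_of_oseen
    (hcont : ContinuousOn (uncurry w) (Iio 0 ×ˢ univ))
    (hM0 : 0 ≤ M) (hM : ∀ t < 0, ∀ x, ‖w t x‖ ≤ M)
    (hanc : IsAncientMildSolution 1 w)
    (hmild : ∀ s t : ℝ, s < t → t < 0 → ∀ x,
      w t x = UnboundedOperators.heatExtension (w s) (t - s) x - oseenDuhamel 1 s w w t x)
    {t₀ : ℝ} (ht₀ : t₀ < 0) :
    ∃ q : ℝ → EuclideanSpace ℝ (Fin 3) → ℝ, IsClassicalNSSolutionOn (Ioo t₀ 0) 1 0 w q := by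
  have hT : 0 < -t₀ := neg_pos.2 ht₀
  have hslice : ∀ {τ : ℝ}, τ < 0 → Continuous (w τ) := fun {τ} hτ =>
    hcont.comp_continuous (continuous_const.prodMk continuous_id) fun x => ⟨hτ, mem_univ _⟩
  set v : ℝ → EuclideanSpace ℝ (Fin 3) → EuclideanSpace ℝ (Fin 3) := fun t => w (t + t₀) with hv
  -- mild solution in duality form from the datum `w t₀` on `(0, -t₀)`
  have hmild' : IsMildNSSolutionOn (Ioo 0 (-t₀)) 1 0 (w t₀) v :=
    (hanc.isMildNSSolutionOn_translate t₀).mono Ioo_subset_Ico_self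
  -- joint smoothness of the translate
  have hsmI : IsSmoothSpaceTimeOn (Iio 0) w := isSmoothSpaceTimeOn_of_oseen hcont hM0 hM hmild
  have hsm : IsSmoothSpaceTimeOn (Ioo 0 (-t₀)) v := by
    refine (hsmI.comp_add_right t₀).mono fun t ht => ?_
    simp only [mem_preimage, mem_Iio]
    linarith [ht.2]
  -- uniform bound on `(0, T₁)`
  have hbdd : ∀ T₁ ∈ Ioo 0 (-t₀), ∃ K : ℝ≥0∞, K < ⊤ ∧ ∀ t ∈ Ioo 0 T₁, eLpNorm (v t) ∞ volume ≤ K := by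
    intro T₁ hT₁
    refine ⟨ENNReal.ofReal M, ENNReal.ofReal_lt_top, fun t ht => ?_⟩
    rw [eLpNorm_exponent_top]
    refine eLpNormEssSup_le_of_ae_bound (Eventually.of_forall fun x => ?_)
    exact hM (t + t₀) (by linarith [ht.2, hT₁.2]) x
  -- the datum: measurable and integrable against Gaussians (bounded)
  have hu₀m : AEStronglyMeasurable (w t₀) volume := (hslice ht₀).aestronglyMeasurable
  have hu₀G : ∀ a : ℝ, 0 < a →
      Integrable (fun y => UnboundedOperators.heatKernel a y * ‖w t₀ y‖) volume := by
    intro a ha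
    have hK : Integrable (UnboundedOperators.heatKernel (E := EuclideanSpace ℝ (Fin 3)) a) volume :=
      UnboundedOperators.integrable_heatKernel_holds ha
    have h := hK.bdd_mul (c := M) hu₀m.norm
      (Eventually.of_forall fun y => by
        rw [norm_norm]; exact hM t₀ ht₀ y)
    refine h.congr (Eventually.of_forall fun y => ?_)
    simp only [mul_comm]
  obtain ⟨q, hcl⟩ := classical_of_smooth_isMildNSSolutionOn_holds (EuclideanSpace ℝ (Fin 3))
    one_pos hT hu₀m hu₀G hsm hbdd hmild'
  -- translate back to `(t₀, 0)`
  refine ⟨fun t => q (t - t₀), ?_⟩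
  have h1 := hcl.comp_add_right (-t₀)
  have hset : (fun t : ℝ => t + -t₀) ⁻¹' Ioo 0 (-t₀) = Ioo t₀ 0 := by
    ext t
    simp only [mem_preimage, mem_Ioo]
    constructor
    · rintro ⟨h1, h2⟩; exact ⟨by linarith, by linarith⟩
    · rintro ⟨h1, h2⟩; exact ⟨by linarith, by linarith⟩
  rw [hset] at h1
  have hf : (fun t : ℝ => (0 : ℝ → EuclideanSpace ℝ (Fin 3) → EuclideanSpace ℝ (Fin 3)) (t + -t₀)) = 0 := by
    funext t; rfl
  have hu' : (fun t : ℝ => v (t + -t₀)) = w := by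
    funext t; simp only [hv]; congr 1; ring
  have hp' : (fun t : ℝ => q (t + -t₀)) = fun t => q (t - t₀) := by
    funext t; rw [← sub_eq_add_neg]
  rw [hf, hu', hp'] at h1
  exact h1

/-! ### Gluing the window pressures -/

/-- **Two classical pressures of the same velocity differ by a function of time**: if `(w, q)` and
`(w, q')` are classical solutions (same `ν`, `f`) on an open time interval `I`, then for `t ∈ I` the
slice `q(t, ·) − q'(t, ·)` is constant (both gradients equal `νΔw − ∂ₜw − (w·∇)w + f` pointwise,
and a smooth function on `ℝ³` with vanishing gradient is constant). [folklore] -/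
theorem pressure_sub_const_of_classical {ν : ℝ} {f : ℝ → EuclideanSpace ℝ (Fin 3) → EuclideanSpace ℝ (Fin 3)}
    {q q' : ℝ → EuclideanSpace ℝ (Fin 3) → ℝ} {a b : ℝ}
    (h : IsClassicalNSSolutionOn (Ioo a b) ν f w q) (h' : IsClassicalNSSolutionOn (Ioo a b) ν f w q')
    {t : ℝ} (ht : t ∈ Ioo a b) (x y : EuclideanSpace ℝ (Fin 3)) :
    q t x - q' t x = q t y - q' t y := by
  have hgrad : ∀ z, gradient (q t) z = gradient (q' t) z := by
    intro z
    have h1 := h.momentum t ht z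
    have h2 := h'.momentum t ht z
    have e : ν • (Δ (w t)) z - gradient (q t) z + f t z = ν • (Δ (w t)) z - gradient (q' t) z + f t z := by
      rw [← h1, ← h2]
    have e2 : gradient (q t) z = gradient (q' t) z := by
      have := congrArg (fun v => ν • (Δ (w t)) z + f t z - v) e
      simpa using this
    exact e2
  have hdq : Differentiable ℝ (q t) := (h.contDiff_pressure ht).differentiable (by simp)
  have hdq' : Differentiable ℝ (q' t) := (h'.contDiff_pressure ht).differentiable (by simp)
  have hfd : ∀ z, fderiv ℝ (fun z => q t z - q' t z) z = 0 := by
    intro z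
    show fderiv ℝ (q t - q' t) z = 0
    rw [fderiv_sub (hdq z) (hdq' z)]
    have h1 : fderiv ℝ (q t) z = fderiv ℝ (q' t) z := by
      have := hgrad z
      rw [gradient, gradient] at this
      exact (InnerProductSpace.toDual ℝ (EuclideanSpace ℝ (Fin 3))).symm.injective this
    rw [h1, sub_self]
  exact is_const_of_fderiv_eq_zero (hdq.sub hdq') hfd x y

/-- **An Oseen-mild continuous bounded ancient field with weakly divergence-free slices is a
classical solution of the unforced Navier–Stokes system (`ν = 1`) on `ℝ³ × ]-∞, 0[`** for one
smooth pressure `P` (Seregin–Šverák 2009, Thm. 2.4: mild bounded ancient solutions are smooth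
solutions): the window pressures `qₙ` of `exists_isClassicalNSSolutionOn_window_of_oseen` on
`]-(n+1), 0[`, normalised by `qₙ(t, 0) = 0`, agree on overlaps (`pressure_sub_const_of_classical`)
and glue to `P(t, x) = q_{⌈-t⌉}(t, x) − q_{⌈-t⌉}(t, 0)`; the momentum equation on `]-∞, 0[` is
the window one (`∂ₜ` within nested open time sets agree, `∇(q − c(t)) = ∇q`). -/
theorem exists_isClassicalNSSolutionOn_Iio_of_oseen
    (hcont : ContinuousOn (uncurry w) (Iio 0 ×ˢ univ))
    (hM0 : 0 ≤ M) (hM : ∀ t < 0, ∀ x, ‖w t x‖ ≤ M)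
    (hanc : IsAncientMildSolution 1 w)
    (hmild : ∀ s t : ℝ, s < t → t < 0 → ∀ x,
      w t x = UnboundedOperators.heatExtension (w s) (t - s) x - oseenDuhamel 1 s w w t x) :
    ∃ P : ℝ → EuclideanSpace ℝ (Fin 3) → ℝ, IsClassicalNSSolutionOn (Iio 0) 1 0 w P := by
  -- the window pressures
  have hwin : ∀ n : ℕ, ∃ q : ℝ → EuclideanSpace ℝ (Fin 3) → ℝ,
      IsClassicalNSSolutionOn (Ioo (-((n : ℝ) + 1)) 0) 1 0 w q := fun n =>
    exists_isClassicalNSSolutionOn_window_of_oseen hcont hM0 hM hanc hmild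
      (by have : (0 : ℝ) ≤ n := n.cast_nonneg; linarith)
  choose q hq using hwin
  -- consistency of the normalised pressures on overlaps
  have hcons : ∀ n m : ℕ, ∀ t : ℝ, -((n : ℝ) + 1) < t → -((m : ℝ) + 1) < t → t < 0 → ∀ x,
      q n t x - q n t 0 = q m t x - q m t 0 := by
    intro n m t hn hm ht x
    -- restrict both to the smaller window `]max, 0[`
    set c : ℝ := max (-((n : ℝ) + 1)) (-((m : ℝ) + 1)) with hc
    have hcn : Ioo c 0 ⊆ Ioo (-((n : ℝ) + 1)) 0 := Ioo_subset_Ioo (le_max_left _ _) le_rfl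
    have hcm : Ioo c 0 ⊆ Ioo (-((m : ℝ) + 1)) 0 := Ioo_subset_Ioo (le_max_right _ _) le_rfl
    have hct : t ∈ Ioo c 0 := ⟨max_lt hn hm, ht⟩
    have h1 := (hq n).mono hcn (uniqueDiffOn_Ioo _ _)
    have h2 := (hq m).mono hcm (uniqueDiffOn_Ioo _ _)
    have key := pressure_sub_const_of_classical h1 h2 hct x 0
    linarith
  -- the index of the window used at time `t`
  set N : ℝ → ℕ := fun t => ⌈-t⌉₊ with hN
  have hNt : ∀ t : ℝ, t < 0 → -((N t : ℝ) + 1) < t := fun t _ => by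
    have h1 : -t ≤ (N t : ℝ) := Nat.le_ceil (-t)
    linarith
  set P : ℝ → EuclideanSpace ℝ (Fin 3) → ℝ := fun t x => q (N t) t x - q (N t) t 0 with hP
  -- `P` agrees with the `n`-th normalised pressure on the whole `n`-th window
  have hPn : ∀ n : ℕ, ∀ t : ℝ, -((n : ℝ) + 1) < t → t < 0 → ∀ x,
      P t x = q n t x - q n t 0 := fun n t hn ht x =>
    hcons (N t) n t (hNt t ht) hn ht x
  have hsmI : IsSmoothSpaceTimeOn (Iio 0) w := isSmoothSpaceTimeOn_of_oseen hcont hM0 hM hmild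
  refine ⟨P, ⟨hsmI, ?_, ?_, ?_⟩⟩
  · -- joint smoothness of `P`: locally it is a window pressure minus its value on the axis `x = 0`
    intro z hz
    have hz1 : z.1 < 0 := hz.1
    set n : ℕ := N z.1 with hn
    set O : Set (ℝ × EuclideanSpace ℝ (Fin 3)) := Ioo (-((n : ℝ) + 1)) 0 ×ˢ univ with hO
    have hOo : IsOpen O := isOpen_Ioo.prod isOpen_univ
    have hzO : z ∈ O := ⟨⟨hNt z.1 hz1, hz1⟩, mem_univ _⟩
    have hqs : ContDiffOn ℝ ∞ (uncurry (q n)) O := (hq n).smooth_pressure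
    have hq0 : ContDiffOn ℝ ∞ (fun z' : ℝ × EuclideanSpace ℝ (Fin 3) => q n z'.1 0) O := by
      have hmap : ContDiff ℝ ∞ (fun z' : ℝ × EuclideanSpace ℝ (Fin 3) =>
          ((z'.1, (0 : EuclideanSpace ℝ (Fin 3))) : ℝ × EuclideanSpace ℝ (Fin 3))) :=
        contDiff_fst.prodMk contDiff_const
      refine hqs.comp hmap.contDiffOn fun z' hz' => ⟨hz'.1, mem_univ _⟩
    have hPn' : ContDiffOn ℝ ∞ (fun z' : ℝ × EuclideanSpace ℝ (Fin 3) => q n z'.1 z'.2 - q n z'.1 0) O :=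
      hqs.sub hq0
    have heq : (uncurry P) =ᶠ[𝓝 z] fun z' : ℝ × EuclideanSpace ℝ (Fin 3) => q n z'.1 z'.2 - q n z'.1 0 := by
      filter_upwards [hOo.mem_nhds hzO] with z' hz'
      exact hPn n z'.1 hz'.1.1 hz'.1.2 z'.2
    exact ((hPn'.contDiffAt (hOo.mem_nhds hzO)).congr_of_eventuallyEq heq).contDiffWithinAt
  · -- the momentum equation on `]-∞, 0[`
    intro t ht x
    have ht0 : t < 0 := ht
    set n : ℕ := N t with hn
    have htn : t ∈ Ioo (-((n : ℝ) + 1)) 0 := ⟨hNt t ht0, ht0⟩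
    have hmom := (hq n).momentum t htn x
    have hd : timeDerivWithin (Iio 0) w t x = timeDerivWithin (Ioo (-((n : ℝ) + 1)) 0) w t x := by
      simp only [timeDerivWithin_apply]
      rw [derivWithin_of_isOpen isOpen_Iio ht0, derivWithin_of_isOpen isOpen_Ioo htn]
    have hg : gradient (P t) x = gradient (q n t) x := by
      have e : P t = fun y => q n t y - q n t 0 := rfl
      rw [e, gradient, gradient, fderiv_sub_const]
    rw [hd, hg]
    exact hmom
  · -- divergence free
    intro t ht
    exact (hq (N t)).divFree t ⟨hNt t ht, ht⟩

end HardyAncientLimit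

end Summit.NavierStokesRegularity.NavierStokesRegularity.Theorems

end
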